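import Summits.AtomisticToContinuum.Crystallization.Theses.SpectralChargeLedger
import Summits.AtomisticToContinuum.Crystallization.Theses.PhononSlackCertificates
import Literature.Geometry.DiscreteGeometry.TwoShellPatterns

/-!
# Sketch — crux-ideate stmt-AtomisticToContinuum-17044 (`SummedShellPricing`), round 1, ideator 1

First lemmas of the three idea cards (`stability-split-glue`, `closed-goodness-compactness`,
`sparse-stopping-time`).  Everything is stated over existing declarations; `sorry` only in the
lemmas marked as targets of a line, the two glue theorems are proved.
-/

noncomputable section

open scoped BigOperators
open Literature.MathematicalPhysics.StatisticalMechanics Literature.Geometry.DiscreteGeometry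

namespace Summit.AtomisticToContinuum.Crystallization.Cruxes.SummedShellPricing.IdeatorOne

/-- Euclidean three-space. -/
abbrev E3 := EuclideanSpace ℝ (Fin 3)

/-- The periodic infimum `e⋆` (verbatim the constant of K1). -/
def eStar : ℝ := ⨅ Q : PeriodicConfiguration 3, Q.energyPerParticle lennardJones

/-- The relaxed-Barlow cell box of K1. -/
def InBox (a₀ h₀ : ℝ) : Prop := 47 / 50 ≤ a₀ ∧ a₀ ≤ 1 ∧ |h₀ - a₀ * Real.sqrt (2 / 3)| ≤ a₀ / 100

/-- `δ`-separation of a finite configuration. -/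
def Sep (δ : ℝ) {N : ℕ} (y : Fin N → E3) : Prop := ∀ i j : Fin N, i ≠ j → δ ≤ dist (y i) (y j)

/-- K1's matching predicate (verbatim the disjunction inside `SummedShellPricing`): the open
`13/10·a₀`-shell of site `i` is `τ`-matched, after a linear isometry and bijectively, to the 12-shell
of `hcpStacking a₀ h₀` or of `fccStacking a₀ h₀`. -/
def GoodShellAt (a₀ h₀ τ : ℝ) {N : ℕ} (y : Fin N → E3) (i : Fin N) : Prop :=
  ∃ A : E3 →ₗᵢ[ℝ] E3,
    (∃ e : ↥{z : E3 | z ∈ Set.range y ∧ z ≠ y i ∧ dist z (y i) < 13 / 10 * a₀} ≃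
        ↥{p : E3 | p ∈ hcpStacking a₀ h₀ ∧ p ≠ 0 ∧ ‖p‖ < 13 / 10 * a₀},
      ∀ t : ↥{z : E3 | z ∈ Set.range y ∧ z ≠ y i ∧ dist z (y i) < 13 / 10 * a₀},
        dist ((t : E3) - y i)
          (A ((e t : ↥{p : E3 | p ∈ hcpStacking a₀ h₀ ∧ p ≠ 0 ∧ ‖p‖ < 13 / 10 * a₀}) : E3)) ≤ τ) ∨
    (∃ e : ↥{z : E3 | z ∈ Set.range y ∧ z ≠ y i ∧ dist z (y i) < 13 / 10 * a₀} ≃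
        ↥{p : E3 | p ∈ fccStacking a₀ h₀ ∧ p ≠ 0 ∧ ‖p‖ < 13 / 10 * a₀},
      ∀ t : ↥{z : E3 | z ∈ Set.range y ∧ z ≠ y i ∧ dist z (y i) < 13 / 10 * a₀},
        dist ((t : E3) - y i)
          (A ((e t : ↥{p : E3 | p ∈ fccStacking a₀ h₀ ∧ p ≠ 0 ∧ ‖p‖ < 13 / 10 * a₀}) : E3)) ≤ τ)

open Classical in
/-- Number of `τ`-bad first shells at cell `(a₀,h₀)`. -/
def badCount (a₀ h₀ τ : ℝ) {N : ℕ} (y : Fin N → E3) : ℕ :=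
  (Finset.univ.filter fun i => ¬ GoodShellAt a₀ h₀ τ y i).card

/-- Read-back: K1 with the named predicate (definitional). -/
theorem summedShellPricing_iff :
    Theses.SpectralChargeLedger.SummedShellPricing ↔
      ∀ δ : ℝ, 0 < δ → ∃ a₀ h₀ : ℝ, 47 / 50 ≤ a₀ ∧ a₀ ≤ 1 ∧ |h₀ - a₀ * Real.sqrt (2 / 3)| ≤ a₀ / 100 ∧
        ∀ τ : ℝ, 0 < τ → τ ≤ 1 → ∃ κ : ℝ, 0 < κ ∧ ∀ (N : ℕ) (y : Fin N → E3), Sep δ y →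
          ∀ B : Finset (Fin N), (∀ i ∈ B, ¬ GoodShellAt a₀ h₀ τ y i) →
            κ * (B.card : ℝ) ≤ interactionEnergy lennardJones y - (N : ℝ) * eStar :=
  Iff.rfl

/-! ## Card B, lemma 1 — K1 is EXACTLY "density wall ∧ sparse linear pricing" (pure logic) -/

/-- WALL (positive bad fraction ⇒ energy-density gap) and SPARSE (linear pricing below a bad
fraction `b₀`), at one common cell. -/
def WallAndSparse : Prop :=
  ∀ δ : ℝ, 0 < δ → ∃ a₀ h₀ : ℝ, InBox a₀ h₀ ∧ ∀ τ : ℝ, 0 < τ → τ ≤ 1 →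
    (∀ t : ℝ, 0 < t → ∃ κ : ℝ, 0 < κ ∧ ∀ (N : ℕ) (y : Fin N → E3), Sep δ y →
        t * (N : ℝ) ≤ (badCount a₀ h₀ τ y : ℝ) →
          (N : ℝ) * (eStar + κ) ≤ interactionEnergy lennardJones y) ∧
    (∃ b₀ : ℝ, 0 < b₀ ∧ ∃ κ : ℝ, 0 < κ ∧ ∀ (N : ℕ) (y : Fin N → E3), Sep δ y →
        (badCount a₀ h₀ τ y : ℝ) ≤ b₀ * N →
          κ * (badCount a₀ h₀ τ y : ℝ) ≤ interactionEnergy lennardJones y - (N : ℝ) * eStar)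

theorem badCount_le {a₀ h₀ τ : ℝ} {N : ℕ} (y : Fin N → E3) : badCount a₀ h₀ τ y ≤ N := by
  classical
  unfold badCount
  exact (Finset.card_filter_le _ _).trans (by simp)

theorem card_le_badCount {a₀ h₀ τ : ℝ} {N : ℕ} (y : Fin N → E3) (B : Finset (Fin N))
    (hB : ∀ i ∈ B, ¬ GoodShellAt a₀ h₀ τ y i) : B.card ≤ badCount a₀ h₀ τ y := by
  classical
  unfold badCount
  exact Finset.card_le_card fun i hi => Finset.mem_filter.2 ⟨Finset.mem_univ _, hB i hi⟩

/-- **K1 ⟺ Wall ∧ Sparse** (case split on the bad fraction; no energy input). -/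
theorem summedShellPricing_iff_wallAndSparse :
    Theses.SpectralChargeLedger.SummedShellPricing ↔ WallAndSparse := by
  classical
  rw [summedShellPricing_iff]
  constructor
  · intro h δ hδ
    obtain ⟨a₀, h₀, ha, ha', hh, hK⟩ := h δ hδ
    refine ⟨a₀, h₀, ⟨ha, ha', hh⟩, fun τ hτ hτ1 => ?_⟩
    obtain ⟨κ, hκ, hP⟩ := hK τ hτ hτ1
    have hbad : ∀ (N : ℕ) (y : Fin N → E3), Sep δ y →
        κ * (badCount a₀ h₀ τ y : ℝ) ≤ interactionEnergy lennardJones y - (N : ℝ) * eStar := by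
      intro N y hsep
      have := hP N y hsep (Finset.univ.filter fun i => ¬ GoodShellAt a₀ h₀ τ y i)
        (fun i hi => (Finset.mem_filter.1 hi).2)
      simpa [badCount] using this
    refine ⟨fun t ht => ⟨κ * t, mul_pos hκ ht, fun N y hsep htN => ?_⟩, ⟨1, one_pos, κ, hκ, fun N y hsep _ => hbad N y hsep⟩⟩
    have h1 := hbad N y hsep
    have h2 : κ * (t * (N : ℝ)) ≤ κ * (badCount a₀ h₀ τ y : ℝ) := mul_le_mul_of_nonneg_left htN hκ.le
    nlinarith [h1, h2]
  · intro h δ hδ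
    obtain ⟨a₀, h₀, ⟨ha, ha', hh⟩, hK⟩ := h δ hδ
    refine ⟨a₀, h₀, ha, ha', hh, fun τ hτ hτ1 => ?_⟩
    obtain ⟨hW, b₀, hb₀, κs, hκs, hS⟩ := hK τ hτ hτ1
    obtain ⟨κw, hκw, hWt⟩ := hW b₀ hb₀
    refine ⟨min κs κw, lt_min hκs hκw, fun N y hsep B hB => ?_⟩
    have hBle : (B.card : ℝ) ≤ (badCount a₀ h₀ τ y : ℝ) := by exact_mod_cast card_le_badCount y B hB
    have hbN : (badCount a₀ h₀ τ y : ℝ) ≤ N := by exact_mod_cast badCount_le y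
    have hmin1 : min κs κw ≤ κs := min_le_left _ _
    have hmin2 : min κs κw ≤ κw := min_le_right _ _
    have hmin0 : 0 < min κs κw := lt_min hκs hκw
    by_cases hcase : (badCount a₀ h₀ τ y : ℝ) ≤ b₀ * N
    · have h1 := hS N y hsep hcase
      calc min κs κw * (B.card : ℝ) ≤ κs * (badCount a₀ h₀ τ y : ℝ) :=
            mul_le_mul hmin1 hBle (Nat.cast_nonneg _) hκs.le
        _ ≤ _ := h1
    · push Not at hcase
      have h1 := hWt N y hsep hcase.le
      calc min κs κw * (B.card : ℝ) ≤ κw * (N : ℝ) :=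
            mul_le_mul hmin2 (hBle.trans hbN) (Nat.cast_nonneg _) hκw.le
        _ ≤ _ := by nlinarith [h1]

/-! ## Card B, lemma 2 — CLOSED GOODNESS (finite shadow; target of the line, not proved here)

For `τ < 29a₀/100` matched shell points have norm `≤ 1.01·a₀ + τ < 13/10·a₀`, and a limit point of
points outside the open `13/10·a₀`-ball stays outside it; so goodness passes to limits. -/
theorem goodShellAt_of_tendsto {a₀ h₀ τ δ : ℝ} (hbox : InBox a₀ h₀) (hτ : 0 < τ) (hτ' : τ < a₀ / 4)
    (hδ : 0 < δ) {N : ℕ} (y : ℕ → Fin N → E3) (z : Fin N → E3) (i : Fin N)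
    (hsep : ∀ k, Sep δ (y k)) (hlim : Filter.Tendsto y Filter.atTop (nhds z))
    (hgood : ∀ k, GoodShellAt a₀ h₀ τ (y k) i) : GoodShellAt a₀ h₀ τ z i := by
  sorry

/-! ## Card A — two-price ledger glued onto `CoerciveTwoShellGap` (stmt-13956)

`ExactCellCoercivity` is the K1-specific perturbative statement: mildly bad sites (τ-bad first shell
at the exact cell but 1/20-two-shell-good) cost `c(τ)`, grossly bad sites get an allowance `C`. -/
open Classical in
def ExactCellCoercivity : Prop :=
  ∀ δ : ℝ, 0 < δ → ∃ a₀ h₀ : ℝ, InBox a₀ h₀ ∧ ∃ C : ℝ, 0 ≤ C ∧ ∀ τ : ℝ, 0 < τ → τ ≤ 1 →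
    ∃ c : ℝ, 0 < c ∧ ∀ (N : ℕ) (y : Fin N → E3), Sep δ y →
      c * ((Finset.univ.filter fun i =>
              ¬ GoodShellAt a₀ h₀ τ y i ∧ IsTwoShellGood (1 / 20) (47 / 50) 1 y i).card : ℝ)
        - C * ((Finset.univ.filter fun i => ¬ IsTwoShellGood (1 / 20) (47 / 50) 1 y i).card : ℝ)
        ≤ interactionEnergy lennardJones y - (N : ℝ) * eStar

/-- **Glue of card A**: coarse gap (shared hub crux 13956) + exact-cell coercivity ⇒ K1, with
`κ(τ) = min(g, c(τ)·g/(g+C))/2` (convex combination). -/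
theorem summedShellPricing_of_gap_of_coercivity
    (hgap : Theses.PhononSlackCertificates.CoerciveTwoShellGap) (hco : ExactCellCoercivity) :
    Theses.SpectralChargeLedger.SummedShellPricing := by
  classical
  rw [summedShellPricing_iff]
  intro δ hδ
  obtain ⟨a₀, h₀, ⟨ha, ha', hh⟩, C, hC, hP⟩ := hco δ hδ
  obtain ⟨g, hg, hG⟩ := hgap δ hδ
  refine ⟨a₀, h₀, ha, ha', hh, fun τ hτ hτ1 => ?_⟩
  obtain ⟨c, hc, hcP⟩ := hP τ hτ hτ1
  have hgC : 0 < g + C := by linarith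
  set κ' : ℝ := c * g / (g + C) with hκ'
  have hκ'pos : 0 < κ' := div_pos (mul_pos hc hg) hgC
  have hκ'eq : κ' * (g + C) = c * g := by rw [hκ']; field_simp
  refine ⟨min g κ' / 2, by positivity, fun N y hsep B hB => ?_⟩
  set bS : Finset (Fin N) := Finset.univ.filter fun i => ¬ IsTwoShellGood (1 / 20) (47 / 50) 1 y i
    with hbS
  set mS : Finset (Fin N) := Finset.univ.filter fun i =>
      ¬ GoodShellAt a₀ h₀ τ y i ∧ IsTwoShellGood (1 / 20) (47 / 50) 1 y i with hmS
  set ex : ℝ := interactionEnergy lennardJones y - (N : ℝ) * eStar with hex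
  -- (1) coarse gap: g·b ≤ ex
  have hcard : (Nat.card {i : Fin N // ¬ IsTwoShellGood (1 / 20) (47 / 50) 1 y i} : ℝ) = bS.card := by
    rw [Nat.card_eq_fintype_card, Fintype.card_of_subtype bS (fun x => by simp [hbS])]
  have h1 : g * (bS.card : ℝ) ≤ ex := by
    have := hG N y hsep
    rw [hcard] at this
    rw [hex]; unfold eStar; linarith
  -- (2) perturbative: c·m − C·b ≤ ex
  have h2 : c * (mS.card : ℝ) - C * (bS.card : ℝ) ≤ ex := hcP N y hsep
  -- (3) B ⊆ mS ∪ bS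
  have hBle : (B.card : ℝ) ≤ (mS.card : ℝ) + (bS.card : ℝ) := by
    have hsub : B ⊆ mS ∪ bS := by
      intro i hi
      by_cases hg2 : IsTwoShellGood (1 / 20) (47 / 50) 1 y i
      · exact Finset.mem_union_left _ (Finset.mem_filter.2 ⟨Finset.mem_univ _, hB i hi, hg2⟩)
      · exact Finset.mem_union_right _ (Finset.mem_filter.2 ⟨Finset.mem_univ _, hg2⟩)
    have := (Finset.card_le_card hsub).trans (Finset.card_union_le _ _)
    exact_mod_cast this
  -- (4) algebra
  have hb0 : (0 : ℝ) ≤ bS.card := Nat.cast_nonneg _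
  have hm0 : (0 : ℝ) ≤ mS.card := Nat.cast_nonneg _
  have hex0 : 0 ≤ ex := le_trans (mul_nonneg hg.le hb0) h1
  have h3 : κ' * (mS.card : ℝ) ≤ ex := by
    have h4 : c * g * (mS.card : ℝ) ≤ (g + C) * ex := by nlinarith [h1, h2, hC, hg]
    have h5 : κ' * (g + C) * (mS.card : ℝ) ≤ (g + C) * ex := by rw [hκ'eq]; exact h4
    have h6 : (g + C) * (κ' * (mS.card : ℝ)) ≤ (g + C) * ex := by linarith [h5]
    exact le_of_mul_le_mul_left h6 hgC
  have hminle1 : min g κ' ≤ g := min_le_left _ _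
  have hminle2 : min g κ' ≤ κ' := min_le_right _ _
  have hmin0 : 0 ≤ min g κ' := (lt_min hg hκ'pos).le
  calc min g κ' / 2 * (B.card : ℝ) ≤ min g κ' / 2 * ((mS.card : ℝ) + (bS.card : ℝ)) :=
        mul_le_mul_of_nonneg_left hBle (by positivity)
    _ = (min g κ' * (mS.card : ℝ) + min g κ' * (bS.card : ℝ)) / 2 := by ring
    _ ≤ (κ' * (mS.card : ℝ) + g * (bS.card : ℝ)) / 2 := by
        gcongr
    _ ≤ ex := by linarith [h1, h3]

/-! ## Card C, lemma 1 — LOCALISATION INEQUALITY (cutting out a region costs its `L`-boundary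
plus `C·L⁻³` per site of the region; δ-separation bounds shell counts; `V ≥ −1/12`, `V ≥ −r⁻⁶/6`).
Target of the line; not proved here. -/
theorem localisation_le (δ : ℝ) (hδ : 0 < δ) :
    ∃ C : ℝ, 0 ≤ C ∧ ∀ L : ℝ, 1 ≤ L → ∃ C' : ℝ, 0 ≤ C' ∧
      ∀ (N : ℕ) (y : Fin N → E3), Sep δ y → ∀ S : Finset (Fin N),
        (∑ i ∈ S, ∑ j ∈ S.filter (fun j => i < j), lennardJones (dist (y i) (y j)))
          + (∑ i ∈ Sᶜ, ∑ j ∈ Sᶜ.filter (fun j => i < j), lennardJones (dist (y i) (y j)))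
          - C' * ((S.filter fun i => ∃ j : Fin N, j ∉ S ∧ dist (y i) (y j) ≤ L).card : ℝ)
          - C / L ^ 3 * (S.card : ℝ)
          ≤ interactionEnergy lennardJones y := by
  sorry

open Classical in
/-- Card C's residual statement, THIN-CLUSTER PRICING: if around every bad site the bad set has
density `≤ θ` at every scale `≥ L₀` (no fat aggregation anywhere), linear pricing holds. -/
def ThinClusterPricing : Prop :=
  ∀ δ : ℝ, 0 < δ → ∃ a₀ h₀ : ℝ, InBox a₀ h₀ ∧ ∀ τ : ℝ, 0 < τ → τ ≤ 1 →
    ∃ θ : ℝ, 0 < θ ∧ ∃ L₀ : ℝ, 1 ≤ L₀ ∧ ∃ κ : ℝ, 0 < κ ∧ ∀ (N : ℕ) (y : Fin N → E3), Sep δ y →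
      (∀ i : Fin N, ¬ GoodShellAt a₀ h₀ τ y i → ∀ L : ℝ, L₀ ≤ L →
          ((Finset.univ.filter fun j => ¬ GoodShellAt a₀ h₀ τ y j ∧ dist (y j) (y i) ≤ L).card : ℝ)
            ≤ θ * L ^ 3) →
      κ * (badCount a₀ h₀ τ y : ℝ) ≤ interactionEnergy lennardJones y - (N : ℝ) * eStar

end Summit.AtomisticToContinuum.Crystallization.Cruxes.SummedShellPricing.IdeatorOne
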